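import Summits.QuantumFields.YangMills.Theorems.BalabanUVNodesN21HistoriesConditionalCloseness

/-!
# YM-DAG node N21 (= NE7c) — THE HISTORIES ROAD END TO END FOR THE WINDOWED MODEL-A FAMILY AT THE RECORD: (RESUM) and the conditional closeness DISCHARGED
# (20h `sum_histLaw_modelAW`, 20g `condClose_modelAW`), the source tilt DISCHARGED (23c) — road I's `ShellWeightBound` for the two runs' windowed model-A history
# letters from: NODE O's COMBINATORIAL slot data (counts, window, levels, causal liveness, neighbourhoods with `hgeom`), its statistics and t-free laws on a common space
# with level-0 projections, N16's POINTWISE closeness `hdet` at nominal thresholds, N20's window∕count, the admissible box, the rate, and `AvgMeasurable` — nothing a.e.,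
# nothing law-theoretic left on N21's list

Track A of `YM-PLAN.md` (cell `pub-ymgap`, HUMAN RULING D-0062), node **N21**; R134 fan-out seat `pub-ymgap-dag-n21-d` (s2), generation 6, module 20i.  THEOREMS ONLY: 0 `def`,
0 `sorry`, standard axioms; COUNT-NEUTRAL; KEY-FREE (generic `D : FiniteEpsData F G`); `--supports` the K3⁗ item `SpineGivenEndpointR13Sep` (stmt-QuantumFields-20292) as a helper.
NO Theses import, NO `Node00.Record13` import.  Imports module 20g `BalabanUVNodesN21HistoriesConditionalCloseness` (`shellWeightBound_histories_of_condCloseness_through`,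
`condClose_modelAW`; brings 20h `liveSmallW` ∕ `modelAWeightW` ∕ `sum_histLaw_modelAW` ∕ `liveSmallW_subset` ∕ `isFiniteMeasure_modelAWeightW` ∕ `liveSmall`, 23c
`measurable_ofReal_exp_source_comp`, the `pub-balaban` leaf's `histWeight` ∕ `histShell` ∕ `histLaw` ∕ `smallProd`).

THE POINT (lens v7.0 (t-n⁗)(c′)(d′) executed generically).  Module 20e's interface has ONE slot type `σ` and ONE history type `ι` for every comparison `K`; the windowed model-A
constructor of 20h lives on `Fin (n K)` slots and `Fin (n K) → Bool` histories.  §1 is the transport (lens census ccc): slots are NUMBERED (`σ := ℕ`, slot `i : Fin (n K)` ↦ `i.1`,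
finsets pushed along `Fin.valEmbedding`), histories are LABEL SEQUENCES (`ι := ℕ → Bool`, `τ' ↦ fun j => if h : j < n K then τ' ⟨j, h⟩ else false`, read back by `fun i => τ i.1`);
the leaf's letters are invariant under this re-indexing (`smallProd_map_val`, `histLaw_map_val`).  §2 `shellWeightBound_histories_modelAW` — 20g's
`shellWeightBound_histories_of_condCloseness_through` at the ENCODED windowed model-A family
`ν^X K a t τ := modelAWeightW (Γ0^X K·e^{t·F∘π^X K}) (W K) (live K) (u^X K ∘ val) (a ∘ lvl K ∘ val) (τ ∘ val)`, `small K τ := (liveSmallW (W K) (live K) (τ ∘ val)).map val`,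
`C K := (W K).map val`, `T K := univ.map ext`: its binders `hresX` ((RESUM) — 20h `sum_histLaw_modelAW` after §1), `hcloseX'` (20g `condClose_modelAW` from `hdet` + `hgeom` +
`a ≤ θ`), `hsmall` (`liveSmallW_subset`), finiteness (20h `isFiniteMeasure_modelAWeightW` on the finite tilted laws) are DISCHARGED.  What the caller supplies — the displayed list
of N21 on the histories road after this file: NODE O's slot counts `n K`, windows `W K`, levels `lvl K`, CAUSAL liveness rules `live K` (`hcausal`), neighbourhoods `nbhd K` with
the geometry `hgeom : s ∈ liveSmallW (W K) (live K) τ' → nbhd K s ⊆ liveSmall (live K) τ'`, measurable statistics `u^X K`, t-free finite laws `Γ0^X K` and measurable level-0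
projections `π^X K` on its common space `Ω K`; N16's POINTWISE two-run closeness at nominal thresholds `hdet^X : (∀ c ∈ nbhd K s, u^X K c ω < θ_{lvl c}) → ∣u^X K s ω − u^Y K s ω∣
≤ Δ_{lvl s}` (v1.1 `shellWeightBound_histories_modelAW_window`: asked at the WINDOW slots `s ∈ W K` only); N20's window∕count on `W K`; `Δ_j ≤ ρ_j(1−κ_j)θ_j`; the admissible box (`θ`, `κ`, `ρ`, `κ_min`); the rate `ρ_j ≤ c₁ϑ^j`; `D.AvgMeasurable`.  CONCLUSION: for SOME
assignment admissible at every level, `ShellWeightBound l₀ T A B shA shB (K ↦ C′·ϑ^K)`, `C′ = 2((N₁+1)·ν̄·(e^{l₀}∕(e^{l₀})⁻¹·(4ν̄∕κ_min))·c₁·ϑ^{−N₁})`, for the encoded family's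
history weights and shell parts.

HONEST FRAMING (binding).  [folklore] re-indexing + ONE application of 20g; a MODEL family (the windowed model-A constructor applied to NODE O's letters — nothing of Bałaban's
expansion is typed or asserted; whether print's (2.18) class expansion IS of this shape is NODE O's (t-n⁗) question, not settled here); (M1) for print's FIXED thresholds
untouched (thresholds are SELECTED inside the box); NE7c is NOT PRINTED and NOT PROVED; **N21 is NOT discharged**; K3⁗ NOT claimed; typed 28∕28, discharged count untouched; one
finite four-torus programme at fixed `ε` — NOT ℝ⁴, NOT infinite volume, NOT OS, NOT a mass gap, NOT Clay.  No decl below carries a cite tag.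
-/

set_option autoImplicit false

noncomputable section

open scoped BigOperators ENNReal
open MeasureTheory Set

namespace Summit.QuantumFields.YangMills.Theorems.N21HistoriesModelAEndToEnd

open Literature.MathematicalPhysics.QuantumFieldTheory.Balaban1983to89
open Literature.MathematicalPhysics.QuantumFieldTheory.Balaban1983to89.T4Continuum (T4Family ULoop FiniteEpsData)
open Literature.MathematicalPhysics.QuantumFieldTheory.Balaban1983to89.T4IndicatorShell (smallInd ShellWeightBound)
open T4GenFunBounds (prodObs)
open T4ShellMeasureLevels (LiveWindow)
open Summit.QuantumFields.BalabanUV.T4Continuum.ShellMeasureRootCompositionHistories (smallProd histWeight histShell histLaw)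
open Summit.QuantumFields.YangMills.Theorems.N21HistoriesModelADefs (liveSmall)
open Summit.QuantumFields.YangMills.Theorems.N21HistoriesWindowedModelADefs
  (liveSmallW modelAWeightW liveSmallW_subset sum_histLaw_modelAW isFiniteMeasure_modelAWeightW)
open Summit.QuantumFields.YangMills.Theorems.N21HistoriesConditionalCloseness (shellWeightBound_histories_of_condCloseness_through condClose_modelAW)
open Summit.QuantumFields.YangMills.Theorems.N21SourceTiltJointSpace (measurable_ofReal_exp_source_comp)

/-! ## §1 transport: numbered slots, label-sequence histories -/

section Transport

variable {Ω : Type*} {n : ℕ}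

/-- the leaf's indicator product is invariant under numbering the slots (`Finset.prod_map` along `Fin.valEmbedding`). [folklore] -/
theorem smallProd_map_val (sm : Finset (Fin n)) (u : ℕ → Ω → ℝ) (ϑ : ℕ → ℝ) (ω : Ω) :
    smallProd (sm.map Fin.valEmbedding) u ϑ ω = smallProd sm (fun i => u i.1) (fun i => ϑ i.1) ω := by
  unfold smallProd
  exact Finset.prod_map _ _ _

variable [MeasurableSpace Ω]

/-- … hence so is the history's law. [folklore] -/
theorem histLaw_map_val (ν : Measure Ω) (sm : Finset (Fin n)) (u : ℕ → Ω → ℝ) (ϑ : ℕ → ℝ) :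
    histLaw ν (sm.map Fin.valEmbedding) u ϑ = histLaw ν sm (fun i => u i.1) (fun i => ϑ i.1) := by
  unfold histLaw
  exact congrArg _ (funext fun ω => by rw [smallProd_map_val])

omit [MeasurableSpace Ω] in
/-- reading a label sequence back on `Fin n` inverts the extension by `false`. [folklore] -/
theorem res_ext (τ' : Fin n → Bool) : (fun i : Fin n => (fun j : ℕ => if h : j < n then τ' ⟨j, h⟩ else false) i.1) = τ' :=
  funext fun i => by simp [i.2]

omit [MeasurableSpace Ω] in
/-- the extension by `false` is injective. [folklore] -/
theorem ext_injective : Function.Injective fun (τ' : Fin n → Bool) (j : ℕ) => if h : j < n then τ' ⟨j, h⟩ else false := fun τ₁ τ₂ h =>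
  funext fun i => by simpa [i.2] using congrFun h i.1

omit [MeasurableSpace Ω] in
/-- the encoded «all window slots small» event reads on `Fin n`. [folklore] -/
theorem forall_mem_map_val_iff {sm : Finset (Fin n)} {P : ℕ → Prop} : (∀ s ∈ sm.map Fin.valEmbedding, P s) ↔ ∀ i ∈ sm, P i.1 :=
  ⟨fun h i hi => h i.1 (Finset.mem_map_of_mem Fin.valEmbedding hi), fun h s hs => by
    obtain ⟨i, hi, rfl⟩ := Finset.mem_map.1 hs
    exact h i hi⟩

end Transport

/-! ## §2 road I end to end for the windowed model-A family at the record -/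

section EndToEnd

variable {F : T4Family} {G : Type*} [GaugeGroup G] [MeasurableSpace G] [HaarData G] [RegularGaugeGroup G]
  (D : FiniteEpsData F G) (g₀ : ℕ → ℝ) (os : List (ULoop F)) (K₀ : ℕ)
  {Ω : ℕ → Type*} [∀ K, MeasurableSpace (Ω K)]
  (n : ℕ → ℕ) (W : ∀ K : ℕ, Finset (Fin (n K))) (live : ∀ K : ℕ, (Fin (n K) → Bool) → Fin (n K) → Bool) (nbhd : ∀ K : ℕ, Fin (n K) → Finset (Fin (n K)))
  (lvl : ℕ → ℕ → ℕ) (uA uB : ∀ K : ℕ, ℕ → Ω K → ℝ)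
  {Γ0A Γ0B : ∀ K : ℕ, Measure (Ω K)} [∀ K, IsFiniteMeasure (Γ0A K)] [∀ K, IsFiniteMeasure (Γ0B K)]
  {πA : ∀ K : ℕ, Ω K → GaugeField ((D.scheme g₀).P (K₀ + K)) 0 G} {πB : ∀ K : ℕ, Ω K → GaugeField ((D.scheme g₀).P (K₀ + K + 1)) 0 G}
  {θ κ ρ Δ : ℕ → ℝ} {l₀ νbar : ℝ} {N₁ : ℕ} {κmin c₁ ϑ : ℝ}

/-- **N21's ROAD I FOR THE WINDOWED MODEL-A FAMILY AT THE RECORD, END TO END.**  See the file header for the displayed list; here run A's encoded history weight at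
`(K, a, t, τ)` is `modelAWeightW (Γ0A K·e^{t·F_{K₀+K}∘πA K}) (W K) (live K) (uA K ∘ val) (a ∘ lvl K ∘ val) (τ ∘ val)` on the live-small window region
`(liveSmallW (W K) (live K) (τ ∘ val)).map val`, run B's the same at step `K₀ + K + 1` with the roles of `uA`, `uB` exchanged in the shell parts.  (RESUM), the conditional
closeness, `small ⊆ window`, finiteness and the tilt are DISCHARGED inside; the causal rules, the geometry `hgeom`, N16's pointwise `hdet`, N20's window∕count, the box and the
rate are the hypotheses.  CONDITIONAL on them; a MODEL family; NE7c NOT proved; N21 NOT discharged. [folklore] -/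
theorem shellWeightBound_histories_modelAW (hM : D.AvgMeasurable) (hπA : ∀ K, Measurable (πA K)) (hπB : ∀ K, Measurable (πB K))
    (huA : ∀ K j, Measurable (uA K j)) (huB : ∀ K j, Measurable (uB K j))
    (hcausalA : ∀ K (τ τ' : Fin (n K) → Bool) (i : Fin (n K)), (∀ j, j < i → τ j = τ' j) → live K τ i = live K τ' i)
    (hgeom : ∀ K (τ' : Fin (n K) → Bool), ∀ s ∈ liveSmallW (W K) (live K) τ', nbhd K s ⊆ liveSmall (live K) τ')
    (hdetA : ∀ K (s : Fin (n K)) (ω : Ω K), (∀ c ∈ nbhd K s, uA K c.1 ω < θ (lvl K c.1)) → |uA K s.1 ω - uB K s.1 ω| ≤ Δ (lvl K s.1))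
    (hdetB : ∀ K (s : Fin (n K)) (ω : Ω K), (∀ c ∈ nbhd K s, uB K c.1 ω < θ (lvl K c.1)) → |uB K s.1 ω - uA K s.1 ω| ≤ Δ (lvl K s.1))
    (hθ : ∀ j, 0 < θ j) (hκ : ∀ j, 0 < κ j ∧ κ j ≤ 1) (hρ : ∀ j, 0 ≤ ρ j ∧ ρ j < 1)
    (hwin : LiveWindow (fun K => (W K).map Fin.valEmbedding) lvl N₁ νbar)
    (hΔ : ∀ j, Δ j ≤ ρ j * ((1 - κ j) * θ j))
    (hκmin : 0 < κmin) (hκminle : ∀ j, κmin ≤ κ j) (hρhalf : ∀ j, ρ j ≤ 1 / 2)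
    (hϑ0 : 0 < ϑ) (hϑ1 : ϑ < 1) (hrate : ∀ j, ρ j ≤ c₁ * ϑ ^ j) :
    ∃ a : ℕ → ℕ → ℝ, (∀ K j, a K j ∈ Icc ((1 - κ j) * θ j) (θ j)) ∧
      ShellWeightBound l₀ (fun K => (Finset.univ : Finset (Fin (n K) → Bool)).map ⟨fun (τ' : Fin (n K) → Bool) (j : ℕ) => if h : j < n K then τ' ⟨j, h⟩ else false, ext_injective (n := n K)⟩)
        (fun K t τ => histWeight (modelAWeightW ((Γ0A K).withDensity fun ω => ENNReal.ofReal (Real.exp (t * prodObs (D.scheme g₀) (K₀ + K) os (πA K ω))))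
            (W K) (live K) (fun i => uA K i.1) (fun i => a K (lvl K i.1)) (fun i => τ i.1))
          ((liveSmallW (W K) (live K) fun i => τ i.1).map Fin.valEmbedding) (uA K) (fun s => a K (lvl K s)))
        (fun K t τ => histWeight (modelAWeightW ((Γ0B K).withDensity fun ω => ENNReal.ofReal (Real.exp (t * prodObs (D.scheme g₀) (K₀ + K + 1) os (πB K ω))))
            (W K) (live K) (fun i => uB K i.1) (fun i => a K (lvl K i.1)) (fun i => τ i.1))
          ((liveSmallW (W K) (live K) fun i => τ i.1).map Fin.valEmbedding) (uB K) (fun s => a K (lvl K s)))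
        (fun K t τ => histShell (modelAWeightW ((Γ0A K).withDensity fun ω => ENNReal.ofReal (Real.exp (t * prodObs (D.scheme g₀) (K₀ + K) os (πA K ω))))
            (W K) (live K) (fun i => uA K i.1) (fun i => a K (lvl K i.1)) (fun i => τ i.1))
          ((liveSmallW (W K) (live K) fun i => τ i.1).map Fin.valEmbedding) (uA K) (uB K) (fun s => a K (lvl K s)))
        (fun K t τ => histShell (modelAWeightW ((Γ0B K).withDensity fun ω => ENNReal.ofReal (Real.exp (t * prodObs (D.scheme g₀) (K₀ + K + 1) os (πB K ω))))
            (W K) (live K) (fun i => uB K i.1) (fun i => a K (lvl K i.1)) (fun i => τ i.1))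
          ((liveSmallW (W K) (live K) fun i => τ i.1).map Fin.valEmbedding) (uB K) (uA K) (fun s => a K (lvl K s)))
        fun K => (2 * ((N₁ + 1) * νbar * (Real.exp l₀ / (Real.exp l₀)⁻¹ * (2 * (2 * νbar) / κmin)) * c₁ * ϑ⁻¹ ^ N₁)) * ϑ ^ K := by
  -- abbreviations for the two tilted laws and their finiteness (density bounded by `e^{|t|}` on a finite law)
  have hm : ∀ K C, Measurable ((D.scheme g₀).obs K C) := fun K C => D.measurable_avgObs hM K C
  have h1 : ∀ K C U, |(D.scheme g₀).obs K C U| ≤ 1 := fun K C U => D.abs_avgObs_le_one K C U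
  have hfinA : ∀ K t, IsFiniteMeasure ((Γ0A K).withDensity fun ω => ENNReal.ofReal (Real.exp (t * prodObs (D.scheme g₀) (K₀ + K) os (πA K ω)))) :=
    fun K t => isFiniteMeasure_withDensity_ofReal (T4GenFunBounds.integrable_exp_mul_of_bound
      (((T4GenFunBounds.measurable_prodObs _ hm (K₀ + K) os).comp (hπA K)).aemeasurable)
      (Filter.Eventually.of_forall fun ω => T4GenFunBounds.abs_prodObs_le_one _ h1 (K₀ + K) os (πA K ω)) t).hasFiniteIntegral
  have hfinB : ∀ K t, IsFiniteMeasure ((Γ0B K).withDensity fun ω => ENNReal.ofReal (Real.exp (t * prodObs (D.scheme g₀) (K₀ + K + 1) os (πB K ω)))) :=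
    fun K t => isFiniteMeasure_withDensity_ofReal (T4GenFunBounds.integrable_exp_mul_of_bound
      (((T4GenFunBounds.measurable_prodObs _ hm (K₀ + K + 1) os).comp (hπB K)).aemeasurable)
      (Filter.Eventually.of_forall fun ω => T4GenFunBounds.abs_prodObs_le_one _ h1 (K₀ + K + 1) os (πB K ω)) t).hasFiniteIntegral
  haveI hνA : ∀ (K : ℕ) (a : ℕ → ℝ) (t : ℝ) (τ : ℕ → Bool), IsFiniteMeasure
      (modelAWeightW ((Γ0A K).withDensity fun ω => ENNReal.ofReal (Real.exp (t * prodObs (D.scheme g₀) (K₀ + K) os (πA K ω))))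
        (W K) (live K) (fun i => uA K i.1) (fun i => a (lvl K i.1)) (fun i => τ i.1)) := fun K a t τ => by
    haveI := hfinA K t
    exact isFiniteMeasure_modelAWeightW _ _ _ _ _ _
  haveI hνB : ∀ (K : ℕ) (a : ℕ → ℝ) (t : ℝ) (τ : ℕ → Bool), IsFiniteMeasure
      (modelAWeightW ((Γ0B K).withDensity fun ω => ENNReal.ofReal (Real.exp (t * prodObs (D.scheme g₀) (K₀ + K + 1) os (πB K ω))))
        (W K) (live K) (fun i => uB K i.1) (fun i => a (lvl K i.1)) (fun i => τ i.1)) := fun K a t τ => by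
    haveI := hfinB K t
    exact isFiniteMeasure_modelAWeightW _ _ _ _ _ _
  -- (RESUM) for the encoded family, per run: transport along §1, then 20h's partition-of-unity identity
  have hres : ∀ (γ : ∀ K : ℕ, ℝ → Measure (Ω K)) (u : ∀ K : ℕ, ℕ → Ω K → ℝ), (∀ K j, Measurable (u K j)) →
      ∀ (K : ℕ) (a : ℕ → ℝ) (t : ℝ),
      ∑ τ ∈ (Finset.univ : Finset (Fin (n K) → Bool)).map ⟨fun (τ' : Fin (n K) → Bool) (j : ℕ) => if h : j < n K then τ' ⟨j, h⟩ else false, ext_injective (n := n K)⟩,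
        histLaw (modelAWeightW (γ K t) (W K) (live K) (fun i => u K i.1) (fun i => a (lvl K i.1)) (fun i => τ i.1))
          ((liveSmallW (W K) (live K) fun i => τ i.1).map Fin.valEmbedding) (u K) (fun s => a (lvl K s)) = γ K t := by
    intro γ u hu K a t
    rw [Finset.sum_map]
    have hsum := sum_histLaw_modelAW (γ K t) (W K) (live K) (hcausalA K) (u := fun i => u K i.1) (fun i => hu K i.1) (fun i => a (lvl K i.1))
    refine Eq.trans (Finset.sum_congr rfl fun τ' _ => ?_) hsum
    have hτ : (fun i : Fin (n K) => (⟨fun (τ' : Fin (n K) → Bool) (j : ℕ) => if h : j < n K then τ' ⟨j, h⟩ else false, ext_injective (n := n K)⟩ :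
        (Fin (n K) → Bool) ↪ (ℕ → Bool)) τ' i.1) = τ' := funext fun i => by simp [i.2]
    rw [histLaw_map_val, hτ]
  -- conditional closeness for the encoded family, per run: 20g's `condClose_modelAW` from `hdet` + `hgeom` + `a ≤ θ`, transported along §1
  have hclose : ∀ (γ : ∀ K : ℕ, ℝ → Measure (Ω K)) (u v : ∀ K : ℕ, ℕ → Ω K → ℝ), (∀ K j, Measurable (u K j)) →
      (∀ K (s : Fin (n K)) (ω : Ω K), (∀ c ∈ nbhd K s, u K c.1 ω < θ (lvl K c.1)) → |u K s.1 ω - v K s.1 ω| ≤ Δ (lvl K s.1)) →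
      ∀ (K : ℕ) (a : ℕ → ℝ), (∀ j, a j ∈ Icc ((1 - κ j) * θ j) (θ j)) → ∀ t : ℝ,
      ∀ τ ∈ (Finset.univ : Finset (Fin (n K) → Bool)).map ⟨fun (τ' : Fin (n K) → Bool) (j : ℕ) => if h : j < n K then τ' ⟨j, h⟩ else false, ext_injective (n := n K)⟩,
      ∀ s ∈ (liveSmallW (W K) (live K) fun i => τ i.1).map Fin.valEmbedding,
        ∀ᵐ ω ∂(modelAWeightW (γ K t) (W K) (live K) (fun i => u K i.1) (fun i => a (lvl K i.1)) (fun i => τ i.1)),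
          (∀ s' ∈ (liveSmallW (W K) (live K) fun i => τ i.1).map Fin.valEmbedding, u K s' ω < a (lvl K s')) →
            |u K s ω - v K s ω| ≤ Δ (lvl K s) := by
    intro γ u v hu hdet K a ha t τ _ s hs
    obtain ⟨i, hi, rfl⟩ := Finset.mem_map.1 hs
    have key := condClose_modelAW (γ K t) (W K) (live K) (fun j => τ j.1) (uA := fun j => u K j.1) (uB := fun j => v K j.1)
      (fun j => hu K j.1) (a := fun j => a (lvl K j.1)) (θ := fun j => θ (lvl K j.1)) (Δ := fun j => Δ (lvl K j.1)) (nbhd K)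
      (fun s _ ω h => hdet K s ω h) (hgeom K _) (fun c => (ha (lvl K c.1)).2) i hi
    filter_upwards [key] with ω hω hall
    exact hω (forall_mem_map_val_iff.1 hall)
  exact shellWeightBound_histories_of_condCloseness_through D g₀ os K₀ (l₀ := l₀)
    (T := fun K => (Finset.univ : Finset (Fin (n K) → Bool)).map ⟨fun (τ' : Fin (n K) → Bool) (j : ℕ) => if h : j < n K then τ' ⟨j, h⟩ else false, ext_injective (n := n K)⟩)
    (C := fun K => (W K).map Fin.valEmbedding) (small := fun K τ => (liveSmallW (W K) (live K) fun i => τ i.1).map Fin.valEmbedding) (lvl := lvl)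
    (νA := fun K a t τ => modelAWeightW ((Γ0A K).withDensity fun ω => ENNReal.ofReal (Real.exp (t * prodObs (D.scheme g₀) (K₀ + K) os (πA K ω))))
      (W K) (live K) (fun i => uA K i.1) (fun i => a (lvl K i.1)) (fun i => τ i.1))
    (νB := fun K a t τ => modelAWeightW ((Γ0B K).withDensity fun ω => ENNReal.ofReal (Real.exp (t * prodObs (D.scheme g₀) (K₀ + K + 1) os (πB K ω))))
      (W K) (live K) (fun i => uB K i.1) (fun i => a (lvl K i.1)) (fun i => τ i.1))
    hM hπA hπB huA huB (fun K τ _ => Finset.map_subset_map.2 (liveSmallW_subset _ _ _)) hθ hκ hρ hwin hΔ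
    (fun K a ha t _ τ hτ s hs => hclose (fun K t => (Γ0A K).withDensity fun ω => ENNReal.ofReal (Real.exp (t * prodObs (D.scheme g₀) (K₀ + K) os (πA K ω)))) uA uB huA hdetA K a ha t τ hτ s hs)
    (fun K a ha t _ τ hτ s hs => hclose (fun K t => (Γ0B K).withDensity fun ω => ENNReal.ofReal (Real.exp (t * prodObs (D.scheme g₀) (K₀ + K + 1) os (πB K ω)))) uB uA huB hdetB K a ha t τ hτ s hs)
    (fun K a _ t _ => hres (fun K t => (Γ0A K).withDensity fun ω => ENNReal.ofReal (Real.exp (t * prodObs (D.scheme g₀) (K₀ + K) os (πA K ω)))) uA huA K a t) (fun K a _ t _ => hres (fun K t => (Γ0B K).withDensity fun ω => ENNReal.ofReal (Real.exp (t * prodObs (D.scheme g₀) (K₀ + K + 1) os (πB K ω)))) uB huB K a t)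
    hκmin hκminle hρhalf hϑ0 hϑ1 hrate

/-- **v1.1 — THE SAME WITH N16's POINTWISE CLOSENESS ASKED AT THE WINDOW SLOTS ONLY** (`hdetA`∕`hdetB` restricted to `s ∈ W K`: 20g's `condClose_modelAW` reads `hdet` only at
live-small WINDOW slots, `liveSmallW W live τ ⊆ W` — the UV slots outside the window need no two-run closeness).  Otherwise verbatim: here run A's encoded history weight at
`(K, a, t, τ)` is `modelAWeightW (Γ0A K·e^{t·F_{K₀+K}∘πA K}) (W K) (live K) (uA K ∘ val) (a ∘ lvl K ∘ val) (τ ∘ val)` on the live-small window region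
`(liveSmallW (W K) (live K) (τ ∘ val)).map val`, run B's the same at step `K₀ + K + 1` with the roles of `uA`, `uB` exchanged in the shell parts.  (RESUM), the conditional
closeness, `small ⊆ window`, finiteness and the tilt are DISCHARGED inside; the causal rules, the geometry `hgeom`, N16's pointwise `hdet`, N20's window∕count, the box and the
rate are the hypotheses.  CONDITIONAL on them; a MODEL family; NE7c NOT proved; N21 NOT discharged. [folklore] -/
theorem shellWeightBound_histories_modelAW_window (hM : D.AvgMeasurable) (hπA : ∀ K, Measurable (πA K)) (hπB : ∀ K, Measurable (πB K))
    (huA : ∀ K j, Measurable (uA K j)) (huB : ∀ K j, Measurable (uB K j))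
    (hcausalA : ∀ K (τ τ' : Fin (n K) → Bool) (i : Fin (n K)), (∀ j, j < i → τ j = τ' j) → live K τ i = live K τ' i)
    (hgeom : ∀ K (τ' : Fin (n K) → Bool), ∀ s ∈ liveSmallW (W K) (live K) τ', nbhd K s ⊆ liveSmall (live K) τ')
    (hdetA : ∀ K (s : Fin (n K)), s ∈ W K → ∀ ω : Ω K, (∀ c ∈ nbhd K s, uA K c.1 ω < θ (lvl K c.1)) → |uA K s.1 ω - uB K s.1 ω| ≤ Δ (lvl K s.1))
    (hdetB : ∀ K (s : Fin (n K)), s ∈ W K → ∀ ω : Ω K, (∀ c ∈ nbhd K s, uB K c.1 ω < θ (lvl K c.1)) → |uB K s.1 ω - uA K s.1 ω| ≤ Δ (lvl K s.1))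
    (hθ : ∀ j, 0 < θ j) (hκ : ∀ j, 0 < κ j ∧ κ j ≤ 1) (hρ : ∀ j, 0 ≤ ρ j ∧ ρ j < 1)
    (hwin : LiveWindow (fun K => (W K).map Fin.valEmbedding) lvl N₁ νbar)
    (hΔ : ∀ j, Δ j ≤ ρ j * ((1 - κ j) * θ j))
    (hκmin : 0 < κmin) (hκminle : ∀ j, κmin ≤ κ j) (hρhalf : ∀ j, ρ j ≤ 1 / 2)
    (hϑ0 : 0 < ϑ) (hϑ1 : ϑ < 1) (hrate : ∀ j, ρ j ≤ c₁ * ϑ ^ j) :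
    ∃ a : ℕ → ℕ → ℝ, (∀ K j, a K j ∈ Icc ((1 - κ j) * θ j) (θ j)) ∧
      ShellWeightBound l₀ (fun K => (Finset.univ : Finset (Fin (n K) → Bool)).map ⟨fun (τ' : Fin (n K) → Bool) (j : ℕ) => if h : j < n K then τ' ⟨j, h⟩ else false, ext_injective (n := n K)⟩)
        (fun K t τ => histWeight (modelAWeightW ((Γ0A K).withDensity fun ω => ENNReal.ofReal (Real.exp (t * prodObs (D.scheme g₀) (K₀ + K) os (πA K ω))))
            (W K) (live K) (fun i => uA K i.1) (fun i => a K (lvl K i.1)) (fun i => τ i.1))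
          ((liveSmallW (W K) (live K) fun i => τ i.1).map Fin.valEmbedding) (uA K) (fun s => a K (lvl K s)))
        (fun K t τ => histWeight (modelAWeightW ((Γ0B K).withDensity fun ω => ENNReal.ofReal (Real.exp (t * prodObs (D.scheme g₀) (K₀ + K + 1) os (πB K ω))))
            (W K) (live K) (fun i => uB K i.1) (fun i => a K (lvl K i.1)) (fun i => τ i.1))
          ((liveSmallW (W K) (live K) fun i => τ i.1).map Fin.valEmbedding) (uB K) (fun s => a K (lvl K s)))
        (fun K t τ => histShell (modelAWeightW ((Γ0A K).withDensity fun ω => ENNReal.ofReal (Real.exp (t * prodObs (D.scheme g₀) (K₀ + K) os (πA K ω))))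
            (W K) (live K) (fun i => uA K i.1) (fun i => a K (lvl K i.1)) (fun i => τ i.1))
          ((liveSmallW (W K) (live K) fun i => τ i.1).map Fin.valEmbedding) (uA K) (uB K) (fun s => a K (lvl K s)))
        (fun K t τ => histShell (modelAWeightW ((Γ0B K).withDensity fun ω => ENNReal.ofReal (Real.exp (t * prodObs (D.scheme g₀) (K₀ + K + 1) os (πB K ω))))
            (W K) (live K) (fun i => uB K i.1) (fun i => a K (lvl K i.1)) (fun i => τ i.1))
          ((liveSmallW (W K) (live K) fun i => τ i.1).map Fin.valEmbedding) (uB K) (uA K) (fun s => a K (lvl K s)))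
        fun K => (2 * ((N₁ + 1) * νbar * (Real.exp l₀ / (Real.exp l₀)⁻¹ * (2 * (2 * νbar) / κmin)) * c₁ * ϑ⁻¹ ^ N₁)) * ϑ ^ K := by
  -- abbreviations for the two tilted laws and their finiteness (density bounded by `e^{|t|}` on a finite law)
  have hm : ∀ K C, Measurable ((D.scheme g₀).obs K C) := fun K C => D.measurable_avgObs hM K C
  have h1 : ∀ K C U, |(D.scheme g₀).obs K C U| ≤ 1 := fun K C U => D.abs_avgObs_le_one K C U
  have hfinA : ∀ K t, IsFiniteMeasure ((Γ0A K).withDensity fun ω => ENNReal.ofReal (Real.exp (t * prodObs (D.scheme g₀) (K₀ + K) os (πA K ω)))) :=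
    fun K t => isFiniteMeasure_withDensity_ofReal (T4GenFunBounds.integrable_exp_mul_of_bound
      (((T4GenFunBounds.measurable_prodObs _ hm (K₀ + K) os).comp (hπA K)).aemeasurable)
      (Filter.Eventually.of_forall fun ω => T4GenFunBounds.abs_prodObs_le_one _ h1 (K₀ + K) os (πA K ω)) t).hasFiniteIntegral
  have hfinB : ∀ K t, IsFiniteMeasure ((Γ0B K).withDensity fun ω => ENNReal.ofReal (Real.exp (t * prodObs (D.scheme g₀) (K₀ + K + 1) os (πB K ω)))) :=
    fun K t => isFiniteMeasure_withDensity_ofReal (T4GenFunBounds.integrable_exp_mul_of_bound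
      (((T4GenFunBounds.measurable_prodObs _ hm (K₀ + K + 1) os).comp (hπB K)).aemeasurable)
      (Filter.Eventually.of_forall fun ω => T4GenFunBounds.abs_prodObs_le_one _ h1 (K₀ + K + 1) os (πB K ω)) t).hasFiniteIntegral
  haveI hνA : ∀ (K : ℕ) (a : ℕ → ℝ) (t : ℝ) (τ : ℕ → Bool), IsFiniteMeasure
      (modelAWeightW ((Γ0A K).withDensity fun ω => ENNReal.ofReal (Real.exp (t * prodObs (D.scheme g₀) (K₀ + K) os (πA K ω))))
        (W K) (live K) (fun i => uA K i.1) (fun i => a (lvl K i.1)) (fun i => τ i.1)) := fun K a t τ => by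
    haveI := hfinA K t
    exact isFiniteMeasure_modelAWeightW _ _ _ _ _ _
  haveI hνB : ∀ (K : ℕ) (a : ℕ → ℝ) (t : ℝ) (τ : ℕ → Bool), IsFiniteMeasure
      (modelAWeightW ((Γ0B K).withDensity fun ω => ENNReal.ofReal (Real.exp (t * prodObs (D.scheme g₀) (K₀ + K + 1) os (πB K ω))))
        (W K) (live K) (fun i => uB K i.1) (fun i => a (lvl K i.1)) (fun i => τ i.1)) := fun K a t τ => by
    haveI := hfinB K t
    exact isFiniteMeasure_modelAWeightW _ _ _ _ _ _
  -- (RESUM) for the encoded family, per run: transport along §1, then 20h's partition-of-unity identity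
  have hres : ∀ (γ : ∀ K : ℕ, ℝ → Measure (Ω K)) (u : ∀ K : ℕ, ℕ → Ω K → ℝ), (∀ K j, Measurable (u K j)) →
      ∀ (K : ℕ) (a : ℕ → ℝ) (t : ℝ),
      ∑ τ ∈ (Finset.univ : Finset (Fin (n K) → Bool)).map ⟨fun (τ' : Fin (n K) → Bool) (j : ℕ) => if h : j < n K then τ' ⟨j, h⟩ else false, ext_injective (n := n K)⟩,
        histLaw (modelAWeightW (γ K t) (W K) (live K) (fun i => u K i.1) (fun i => a (lvl K i.1)) (fun i => τ i.1))
          ((liveSmallW (W K) (live K) fun i => τ i.1).map Fin.valEmbedding) (u K) (fun s => a (lvl K s)) = γ K t := by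
    intro γ u hu K a t
    rw [Finset.sum_map]
    have hsum := sum_histLaw_modelAW (γ K t) (W K) (live K) (hcausalA K) (u := fun i => u K i.1) (fun i => hu K i.1) (fun i => a (lvl K i.1))
    refine Eq.trans (Finset.sum_congr rfl fun τ' _ => ?_) hsum
    have hτ : (fun i : Fin (n K) => (⟨fun (τ' : Fin (n K) → Bool) (j : ℕ) => if h : j < n K then τ' ⟨j, h⟩ else false, ext_injective (n := n K)⟩ :
        (Fin (n K) → Bool) ↪ (ℕ → Bool)) τ' i.1) = τ' := funext fun i => by simp [i.2]
    rw [histLaw_map_val, hτ]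
  -- conditional closeness for the encoded family, per run: 20g's `condClose_modelAW` from `hdet` + `hgeom` + `a ≤ θ`, transported along §1
  have hclose : ∀ (γ : ∀ K : ℕ, ℝ → Measure (Ω K)) (u v : ∀ K : ℕ, ℕ → Ω K → ℝ), (∀ K j, Measurable (u K j)) →
      (∀ K (s : Fin (n K)), s ∈ W K → ∀ ω : Ω K, (∀ c ∈ nbhd K s, u K c.1 ω < θ (lvl K c.1)) → |u K s.1 ω - v K s.1 ω| ≤ Δ (lvl K s.1)) →
      ∀ (K : ℕ) (a : ℕ → ℝ), (∀ j, a j ∈ Icc ((1 - κ j) * θ j) (θ j)) → ∀ t : ℝ,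
      ∀ τ ∈ (Finset.univ : Finset (Fin (n K) → Bool)).map ⟨fun (τ' : Fin (n K) → Bool) (j : ℕ) => if h : j < n K then τ' ⟨j, h⟩ else false, ext_injective (n := n K)⟩,
      ∀ s ∈ (liveSmallW (W K) (live K) fun i => τ i.1).map Fin.valEmbedding,
        ∀ᵐ ω ∂(modelAWeightW (γ K t) (W K) (live K) (fun i => u K i.1) (fun i => a (lvl K i.1)) (fun i => τ i.1)),
          (∀ s' ∈ (liveSmallW (W K) (live K) fun i => τ i.1).map Fin.valEmbedding, u K s' ω < a (lvl K s')) →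
            |u K s ω - v K s ω| ≤ Δ (lvl K s) := by
    intro γ u v hu hdet K a ha t τ _ s hs
    obtain ⟨i, hi, rfl⟩ := Finset.mem_map.1 hs
    have key := condClose_modelAW (γ K t) (W K) (live K) (fun j => τ j.1) (uA := fun j => u K j.1) (uB := fun j => v K j.1)
      (fun j => hu K j.1) (a := fun j => a (lvl K j.1)) (θ := fun j => θ (lvl K j.1)) (Δ := fun j => Δ (lvl K j.1)) (nbhd K)
      (fun s hs ω h => hdet K s (liveSmallW_subset _ _ _ hs) ω h) (hgeom K _) (fun c => (ha (lvl K c.1)).2) i hi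
    filter_upwards [key] with ω hω hall
    exact hω (forall_mem_map_val_iff.1 hall)
  exact shellWeightBound_histories_of_condCloseness_through D g₀ os K₀ (l₀ := l₀)
    (T := fun K => (Finset.univ : Finset (Fin (n K) → Bool)).map ⟨fun (τ' : Fin (n K) → Bool) (j : ℕ) => if h : j < n K then τ' ⟨j, h⟩ else false, ext_injective (n := n K)⟩)
    (C := fun K => (W K).map Fin.valEmbedding) (small := fun K τ => (liveSmallW (W K) (live K) fun i => τ i.1).map Fin.valEmbedding) (lvl := lvl)
    (νA := fun K a t τ => modelAWeightW ((Γ0A K).withDensity fun ω => ENNReal.ofReal (Real.exp (t * prodObs (D.scheme g₀) (K₀ + K) os (πA K ω))))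
      (W K) (live K) (fun i => uA K i.1) (fun i => a (lvl K i.1)) (fun i => τ i.1))
    (νB := fun K a t τ => modelAWeightW ((Γ0B K).withDensity fun ω => ENNReal.ofReal (Real.exp (t * prodObs (D.scheme g₀) (K₀ + K + 1) os (πB K ω))))
      (W K) (live K) (fun i => uB K i.1) (fun i => a (lvl K i.1)) (fun i => τ i.1))
    hM hπA hπB huA huB (fun K τ _ => Finset.map_subset_map.2 (liveSmallW_subset _ _ _)) hθ hκ hρ hwin hΔ
    (fun K a ha t _ τ hτ s hs => hclose (fun K t => (Γ0A K).withDensity fun ω => ENNReal.ofReal (Real.exp (t * prodObs (D.scheme g₀) (K₀ + K) os (πA K ω)))) uA uB huA hdetA K a ha t τ hτ s hs)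
    (fun K a ha t _ τ hτ s hs => hclose (fun K t => (Γ0B K).withDensity fun ω => ENNReal.ofReal (Real.exp (t * prodObs (D.scheme g₀) (K₀ + K + 1) os (πB K ω)))) uB uA huB hdetB K a ha t τ hτ s hs)
    (fun K a _ t _ => hres (fun K t => (Γ0A K).withDensity fun ω => ENNReal.ofReal (Real.exp (t * prodObs (D.scheme g₀) (K₀ + K) os (πA K ω)))) uA huA K a t) (fun K a _ t _ => hres (fun K t => (Γ0B K).withDensity fun ω => ENNReal.ofReal (Real.exp (t * prodObs (D.scheme g₀) (K₀ + K + 1) os (πB K ω)))) uB huB K a t)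
    hκmin hκminle hρhalf hϑ0 hϑ1 hrate

end EndToEnd

end Summit.QuantumFields.YangMills.Theorems.N21HistoriesModelAEndToEnd

end
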